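import Summits.KontsevichZagierPeriods.KontsevichZagierPeriods.Theorems.RootDecompRelativeModAbsoluteCircleLogP2

/-! # `RootDecompRelativeModAbsoluteCircleLogP3` — part 3/11 of the mechanical ≤400-line split of `CircleLogTranscendence_landing.lean` (sha256 022159109aaffa3a…)
Source: decomp-kz lens-3 g13 `CircleLogTranscendence_v9.lean` (HOME/decomp-kz-lens-3/g13/, sha256 afb45a43…; critic g5-45/60/65/68/69 CLEARED FOR LANDING --supports 30572 (§4 defs, §8–§10 CircleLogStructureAt 0 from the tree's baker_decomposition_complex, constant-data cells every n, §16–§23 descent ingredients); landed by census-1 g9 over the landed CylLogSplitP52 (BLOCK G13): the duplicate def CircleLogStructure is dropped in favour of the landed one).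
Split by census-1 g9 `gen/splitlean.py`: scopes re-opened with their `open`/`variable`/`set_option` context; mathematics and declaration order unchanged. -/

noncomputable section
open Set MeasureTheory Filter Topology
open scoped BigOperators
open Literature.NumberTheory.Transcendental Literature.ModelTheory.ExponentialFields
namespace Summit.KontsevichZagierPeriods.RootDecompRelativeModAbsolute.Rung30571.RegularisedLogLayer.CylLog.Leaf
namespace G13
section AlgPtsCopy
open MvPolynomial

open Set MeasureTheory Filter Topology in
open scoped BigOperators in
open Literature.NumberTheory.Transcendental Literature.ModelTheory.ExponentialFields in
open MvPolynomial in
/-- Auxiliary step `exists_mem_algebraicClosure_of_fin_one` (§9a): exists mem algebraic Closure of fin one. [bookkeeping] -/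
private theorem exists_mem_algebraicClosure_of_fin_one {T : Set (Fin 1 → ℝ)}
    (hT : IsSemialgebraic (algebraicClosure ℚ ℝ) T) (hne : T.Nonempty) :
    ∃ u ∈ T, ∀ j, u j ∈ algebraicClosure ℚ ℝ := by
  classical
  obtain ⟨Q, Sg, rfl⟩ := hT.exists_eq_setOf_signVec_mem
  obtain ⟨u₀, hu₀⟩ := hne
  by_cases hA : ∃ q ∈ Q, q ≠ 0 ∧ aeval u₀ q = 0
  · obtain ⟨q, -, hq0, hqu⟩ := hA
    have hnot : ¬ AlgebraicIndependent (algebraicClosure ℚ ℝ) u₀ := fun hind =>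
      hq0 (hind (by rw [hqu, map_zero]))
    rw [algebraicIndependent_unique_type_iff] at hnot
    have halgK : IsAlgebraic (algebraicClosure ℚ ℝ) (u₀ default) := by
      by_contra h
      exact hnot h
    haveI : Algebra.IsAlgebraic ℚ (algebraicClosure ℚ ℝ) := algebraicClosure.isAlgebraic ℚ ℝ
    have halg : IsAlgebraic ℚ (u₀ default) := halgK.restrictScalars ℚ
    refine ⟨u₀, hu₀, fun j => ?_⟩
    rw [Subsingleton.elim j default]
    exact mem_algebraicClosure_iff.2 halg
  · push Not at hA
    set V : Set (Fin 1 → ℝ) :=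
      {u | ∀ q ∈ Q, SignType.sign (aeval u q) = SignType.sign (aeval u₀ q)} with hV
    have hVT : V ⊆ {x | (fun q : Q => SignType.sign
        (aeval x (q : MvPolynomial (Fin 1) (algebraicClosure ℚ ℝ)))) ∈ Sg} := by
      intro u hu
      have heq : (fun q : Q => SignType.sign
          (aeval u (q : MvPolynomial (Fin 1) (algebraicClosure ℚ ℝ)))) =
          fun q : Q => SignType.sign
            (aeval u₀ (q : MvPolynomial (Fin 1) (algebraicClosure ℚ ℝ))) :=
        funext fun q => hu q q.2
      show _ ∈ Sg
      rw [heq]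
      exact hu₀
    have hVopen : IsOpen V := by
      have hVeq : V = ⋂ q ∈ Q, {u | SignType.sign (aeval u q) = SignType.sign (aeval u₀ q)} := by
        ext u
        simp [hV]
      rw [hVeq]
      refine isOpen_biInter_finset fun q hq => ?_
      by_cases hq0 : q = 0
      · subst hq0
        simp
      · rcases lt_or_gt_of_ne (hA q hq hq0) with hneg | hpos
        · rw [sign_neg hneg]
          simp only [sign_eq_neg_one_iff]
          exact isOpen_lt (continuous_aeval_real q) continuous_const
        · rw [sign_pos hpos]
          simp only [sign_eq_one_iff]
          exact isOpen_lt continuous_const (continuous_aeval_real q)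
    have hu₀V : u₀ ∈ V := fun q _ => rfl
    obtain ⟨ε, hε, hball⟩ := Metric.isOpen_iff.1 hVopen u₀ hu₀V
    obtain ⟨r, hr₁, hr₂⟩ := exists_rat_btwn (show u₀ 0 - ε < u₀ 0 + ε by linarith)
    refine ⟨fun _ => (r : ℝ), hVT (hball ?_), fun _ => ?_⟩
    · rw [Metric.mem_ball, dist_pi_lt_iff hε]
      intro b
      rw [Subsingleton.elim b 0, Real.dist_eq, abs_sub_lt_iff]
      constructor <;> linarith
    · have h : (algebraMap ℚ ℝ r) ∈ algebraicClosure ℚ ℝ := (algebraicClosure ℚ ℝ).algebraMap_mem r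
      rwa [eq_ratCast] at h

open Set MeasureTheory Filter Topology in
open scoped BigOperators in
open Literature.NumberTheory.Transcendental Literature.ModelTheory.ExponentialFields in
open MvPolynomial in
/-- Auxiliary step `exists_mem_algebraicClosure` (§9a): exists mem algebraic Closure. [bookkeeping] -/
private theorem exists_mem_algebraicClosure (n : ℕ) (S : Set (Fin n → ℝ))
    (hS : IsSemialgebraic (algebraicClosure ℚ ℝ) S) (hne : S.Nonempty) :
    ∃ x ∈ S, ∀ i, x i ∈ algebraicClosure ℚ ℝ := by
  induction n with
  | zero =>
    obtain ⟨x, hx⟩ := hne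
    exact ⟨x, hx, fun i => i.elim0⟩
  | succ n ih =>
    obtain ⟨y, hy⟩ := hne
    have hπ := tarski_seidenberg_real_holds (k := algebraicClosure ℚ ℝ) hS
    obtain ⟨a, ⟨z, hz, rfl⟩, ha⟩ := ih _ hπ ⟨_, y, hy, rfl⟩
    set P : Fin (n + 1) → MvPolynomial (Fin 1) (algebraicClosure ℚ ℝ) :=
      Fin.snoc (fun i => C ⟨z (Fin.castSucc i), ha i⟩) (X 0) with hPdef
    have hP : ∀ u : Fin 1 → ℝ,
        (fun j => aeval u (P j)) = Fin.snoc (fun i => z (Fin.castSucc i)) (u 0) := by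
      intro u
      funext j
      refine Fin.lastCases ?_ (fun i => ?_) j
      · simp [hPdef, Fin.snoc_last]
      · simp only [hPdef, Fin.snoc_castSucc, aeval_C]
        rfl
    have hF : IsSemialgebraic (algebraicClosure ℚ ℝ)
        ((fun u : Fin 1 → ℝ => fun j => aeval u (P j)) ⁻¹' S) := hS.preimage_aeval P
    have hFne : ((fun u : Fin 1 → ℝ => fun j => aeval u (P j)) ⁻¹' S).Nonempty := by
      refine ⟨fun _ => z (Fin.last n), ?_⟩
      show (fun j => aeval (fun _ : Fin 1 => z (Fin.last n)) (P j)) ∈ S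
      rw [hP]
      convert hz using 1
      exact Fin.snoc_init_self z
    obtain ⟨u, hu, huK⟩ := exists_mem_algebraicClosure_of_fin_one hF hFne
    refine ⟨_, hu, fun i => ?_⟩
    show (fun j => aeval u (P j)) i ∈ algebraicClosure ℚ ℝ
    rw [hP]
    refine Fin.lastCases ?_ (fun j => ?_) i
    · rw [Fin.snoc_last]
      exact huK 0
    · rw [Fin.snoc_castSucc]
      exact ha j

open Set MeasureTheory Filter Topology in
open scoped BigOperators in
open Literature.NumberTheory.Transcendental Literature.ModelTheory.ExponentialFields in
/-- Real algebraic numbers are algebraic in `ℂ`. -/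
private theorem isAlgebraic_ofReal {x : ℝ} (hx : IsAlgebraic ℚ x) : IsAlgebraic ℚ (x : ℂ) := by
  simpa using hx.algebraMap (A := ℂ)

open Set MeasureTheory Filter Topology in
open scoped BigOperators in
open Literature.NumberTheory.Transcendental Literature.ModelTheory.ExponentialFields in
/-- `i` is algebraic. -/
private theorem isAlgebraic_I : IsAlgebraic ℚ Complex.I := by
  refine ⟨Polynomial.X ^ 2 + Polynomial.C 1, (Polynomial.monic_X_pow_add_C (1:ℚ) two_ne_zero).ne_zero, ?_⟩
  simp [Complex.I_sq]

/-- **A nonempty `ℚ`-semialgebraic subset of `ℝⁿ` contains a point with algebraic coordinates** (`ℝ_alg ≺ ℝ`). -/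
theorem algebraicPoints {n : ℕ} (S : Set (Fin n → ℝ)) (hS : IsSemialgebraic ℚ S) (hne : S.Nonempty) :
    ∃ x ∈ S, ∀ i, IsAlgebraic ℚ (x i) := by
  obtain ⟨x, hx, hxK⟩ :=
    exists_mem_algebraicClosure n S (hS.baseChange (algebraicClosure ℚ ℝ)) hne
  exact ⟨x, hx, fun i => mem_algebraicClosure_iff.1 (hxK i)⟩

end AlgPtsCopy

/-! #### §9b Linear algebra: integer generators of a rational subspace by a projection. -/

set_option linter.deprecated false in
/-- For a subspace `V ⊆ ℚ^k`: integer vectors `f_r ∈ V` (`r < k`) and `D > 0` with `D·N = Σ_r N_r f_r` for every `N ∈ V`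
(`f_r = D · P e_r` for a projection `P` onto `V`). -/
theorem exists_int_proj (k : ℕ) (V : Submodule ℚ (Fin k → ℚ)) :
    ∃ (D : ℕ) (f : Fin k → Fin k → ℤ), 0 < D ∧ (∀ r, (fun i => (f r i : ℚ)) ∈ V) ∧
      ∀ N ∈ V, ∀ i, (D : ℚ) * N i = ∑ r, N r * (f r i : ℚ) := by
  classical
  obtain ⟨Vc, hVc⟩ := V.exists_isCompl
  let P := Submodule.linearProjOfIsCompl V Vc hVc
  obtain ⟨D, fz, hD0, hfz⟩ :=
    exists_int_mul_of_rat (fun ri : Fin k × Fin k => ((P (Pi.single ri.1 1) : V) : Fin k → ℚ) ri.2)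
  refine ⟨D, fun r i => fz (r, i), hD0, fun r => ?_, fun N hN i => ?_⟩
  · have : (fun i => (fz (r, i) : ℚ)) = (D : ℚ) • ((P (Pi.single r 1) : V) : Fin k → ℚ) := by
      funext i; rw [hfz]; simp [mul_comm]
    rw [this]; exact V.smul_mem _ (P (Pi.single r 1)).2
  · have hPN : ((P N : V) : Fin k → ℚ) = N := by
      have h1 := Submodule.linearProjOfIsCompl_apply_left hVc ⟨N, hN⟩
      exact congrArg Subtype.val h1
    have hN' : N = ∑ r, N r • (Pi.single r (1:ℚ) : Fin k → ℚ) := by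
      funext i
      simp [Finset.sum_apply, Pi.single_apply]
    have hPN' : ((P N : V) : Fin k → ℚ) i = ∑ r, N r * ((P (Pi.single r 1) : V) : Fin k → ℚ) i := by
      conv_lhs => rw [hN']
      rw [map_sum, Submodule.coe_sum, Finset.sum_apply]
      exact Finset.sum_congr rfl fun r _ => by rw [map_smul, Submodule.coe_smul, Pi.smul_apply, smul_eq_mul]
    calc (D : ℚ) * N i = (D : ℚ) * ((P N : V) : Fin k → ℚ) i := by rw [hPN]
      _ = ∑ r, N r * (fz (r, i) : ℚ) := by
          rw [hPN', Finset.mul_sum]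
          exact Finset.sum_congr rfl fun r _ => by rw [hfz]; ring

/-! #### §9c Pointwise Baker at algebraic data. -/

/-- The vector of logarithms `(log aᵢ)ᵢ ⊕ (2i·arctan vⱼ)ⱼ`. -/
def ellOf {k l : ℕ} (a : Fin k → ℝ) (v : Fin l → ℝ) : Fin k ⊕ Fin l → ℂ :=
  Sum.elim (fun i => ((Real.log (a i) : ℝ) : ℂ)) (fun j => ((2 * Real.arctan (v j) : ℝ) : ℂ) * Complex.I)

/-- Real and imaginary parts of a rational relation among `ellOf a v`: an additive log relation and an angle relation. -/
theorem rel_re_im {k l : ℕ} (a : Fin k → ℝ) (v : Fin l → ℝ) (N : Fin k ⊕ Fin l → ℚ)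
    (hN : ∑ t, (N t : ℂ) * ellOf a v t = 0) :
    (∑ i, (N (Sum.inl i) : ℝ) * Real.log (a i) = 0) ∧
      (∑ j, (N (Sum.inr j) : ℝ) * Real.arctan (v j) = 0) := by
  have hℓ1re : ∀ i, (ellOf a v (Sum.inl i)).re = Real.log (a i) := fun i => by
    simp only [ellOf, Sum.elim_inl, Complex.ofReal_re]
  have hℓ1im : ∀ i, (ellOf a v (Sum.inl i)).im = 0 := fun i => by
    simp only [ellOf, Sum.elim_inl, Complex.ofReal_im]
  have hℓ2re : ∀ j, (ellOf a v (Sum.inr j)).re = 0 := fun j => by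
    simp only [ellOf, Sum.elim_inr, Complex.mul_re, Complex.ofReal_re, Complex.ofReal_im, Complex.I_re,
      Complex.I_im, mul_zero, zero_mul, sub_zero]
  have hℓ2im : ∀ j, (ellOf a v (Sum.inr j)).im = 2 * Real.arctan (v j) := fun j => by
    simp only [ellOf, Sum.elim_inr, Complex.mul_im, Complex.ofReal_re, Complex.ofReal_im, Complex.I_re,
      Complex.I_im, mul_zero, mul_one, add_zero]
  constructor
  · have h0 := congrArg Complex.re hN
    rw [Fintype.sum_sum_type, Complex.add_re, Complex.re_sum, Complex.re_sum, Complex.zero_re] at h0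
    simp only [Complex.mul_re, Complex.ratCast_re, Complex.ratCast_im, hℓ1re, hℓ1im, hℓ2re, hℓ2im,
      mul_zero, sub_zero, zero_mul, Finset.sum_const_zero, add_zero] at h0
    exact h0
  · have h0 := congrArg Complex.im hN
    rw [Fintype.sum_sum_type, Complex.add_im, Complex.im_sum, Complex.im_sum, Complex.zero_im] at h0
    simp only [Complex.mul_im, Complex.ratCast_re, Complex.ratCast_im, hℓ1re, hℓ1im, hℓ2re, hℓ2im,
      mul_zero, zero_mul, add_zero, Finset.sum_const_zero, zero_add] at h0
    have h2 : ∑ j, (N (Sum.inr j) : ℝ) * Real.arctan (v j) =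
        (∑ j, (N (Sum.inr j) : ℝ) * (2 * Real.arctan (v j))) / 2 := by
      rw [Finset.sum_div]; exact Finset.sum_congr rfl fun j _ => by ring
    rw [h2, h0, zero_div]

/-- **Baker at a point with algebraic data**: `Σ hᵢ log aᵢ + Σ pⱼ arctan vⱼ = g` with everything algebraic, `aᵢ > 0`, forces
`g = 0` and `h`, `p` to be real combinations of the `W`- / `u`-projections of RATIONAL relation vectors of `ellOf a v`. -/
theorem baker_point {k l : ℕ} (a : Fin k → ℝ) (v : Fin l → ℝ) (hc : Fin k → ℝ) (pc : Fin l → ℝ) (gc : ℝ)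
    (ha : ∀ i, IsAlgebraic ℚ (a i)) (ha0 : ∀ i, 0 < a i) (hv : ∀ j, IsAlgebraic ℚ (v j))
    (hh : ∀ i, IsAlgebraic ℚ (hc i)) (hp : ∀ j, IsAlgebraic ℚ (pc j)) (hg : IsAlgebraic ℚ gc)
    (hid : ∑ i, hc i * Real.log (a i) + ∑ j, pc j * Real.arctan (v j) = gc) :
    gc = 0 ∧ ∃ Nr : (Fin k ⊕ Fin l) → (Fin k ⊕ Fin l) → ℚ,
      (∀ J, ∑ t, (Nr J t : ℂ) * ellOf a v t = 0) ∧
      ∃ α β : (Fin k ⊕ Fin l) → ℝ,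
        (∀ i, hc i = ∑ J, α J * (Nr J (Sum.inl i) : ℝ)) ∧
        (∀ j, pc j = ∑ J, β J * (Nr J (Sum.inr j) : ℝ)) := by
  classical
  have h2r : IsAlgebraic ℚ (2 : ℝ) := by simpa using isAlgebraic_nat (R := ℚ) (A := ℝ) 2
  let ℓ : Fin k ⊕ Fin l → ℂ := ellOf a v
  let γ : Fin k ⊕ Fin l → ℂ := Sum.elim (fun i => ((hc i : ℝ) : ℂ))
    (fun j => ((-(pc j) / 2 : ℝ) : ℂ) * Complex.I)
  have hexpℓ : ∀ t, IsAlgebraic ℚ (Complex.exp (ℓ t)) := by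
    rintro (i | j)
    · simp only [ℓ, ellOf, Sum.elim_inl]
      rw [← Complex.ofReal_exp, Real.exp_log (ha0 i)]
      exact isAlgebraic_ofReal (ha i)
    · simp only [ℓ, ellOf, Sum.elim_inr]
      exact isAlgebraic_exp_two_arctan_mul_I (hv j)
  have hγ : ∀ t, IsAlgebraic ℚ (γ t) := by
    rintro (i | j)
    · simp only [γ, Sum.elim_inl]; exact isAlgebraic_ofReal (hh i)
    · simp only [γ, Sum.elim_inr]
      refine (isAlgebraic_ofReal ?_).mul isAlgebraic_I
      rw [div_eq_mul_inv]; exact (hp j).neg.mul h2r.inv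
  have hr : IsAlgebraic ℚ ((-gc : ℝ) : ℂ) := isAlgebraic_ofReal hg.neg
  have hrel : ((-gc : ℝ) : ℂ) + ∑ t, γ t * ℓ t = 0 := by
    have hsum : ∑ t, γ t * ℓ t =
        ((∑ i, hc i * Real.log (a i) + ∑ j, pc j * Real.arctan (v j) : ℝ) : ℂ) := by
      rw [Fintype.sum_sum_type, Complex.ofReal_add, Complex.ofReal_sum, Complex.ofReal_sum]
      congr 1
      · exact Finset.sum_congr rfl fun i _ => by
          simp only [γ, ℓ, ellOf, Sum.elim_inl, Complex.ofReal_mul]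
      · exact Finset.sum_congr rfl fun j _ => by
          simp only [γ, ℓ, ellOf, Sum.elim_inr]
          apply Complex.ext <;>
            simp only [Complex.mul_re, Complex.mul_im, Complex.ofReal_re, Complex.ofReal_im,
              Complex.I_re, Complex.I_im] <;> ring
    rw [hsum, hid, Complex.ofReal_neg, neg_add_cancel]
  obtain ⟨hg0, Nr, hNrel, hNγ⟩ := baker_decomposition_complex ℓ hexpℓ hr hγ hrel
  have hg00 : gc = 0 := by simpa using hg0
  refine ⟨hg00, Nr, hNrel, fun J => (γ J).re, fun J => -2 * (γ J).im, fun i => ?_, fun j => ?_⟩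
  · have h0 := congrArg Complex.re (hNγ (Sum.inl i))
    simp only [Complex.re_sum, Complex.mul_re, Complex.ratCast_re, Complex.ratCast_im, mul_zero,
      sub_zero] at h0
    have h1 : (γ (Sum.inl i)).re = hc i := by simp [γ]
    rw [← h1, h0]
  · have h0 := congrArg Complex.im (hNγ (Sum.inr j))
    simp only [Complex.im_sum, Complex.mul_im, Complex.ratCast_re, Complex.ratCast_im, mul_zero,
      zero_add] at h0
    have h1 : (γ (Sum.inr j)).im = -(pc j) / 2 := by simp [γ]
    rw [h1] at h0
    have h2 : pc j = -2 * ∑ J, (γ J).im * (Nr J (Sum.inr j) : ℝ) := by rw [← h0]; ring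
    rw [h2, Finset.mul_sum]
    exact Finset.sum_congr rfl fun J _ => by ring

/-! #### §9d The relation module and the constant-data case of `CircleLogStructure` (all base dimensions). -/

/-- The `ℚ`-module of rational relations among `ellOf a v`. -/
def relMod {k l : ℕ} (a : Fin k → ℝ) (v : Fin l → ℝ) : Submodule ℚ (Fin k ⊕ Fin l → ℚ) where
  carrier := {N | ∑ t, (N t : ℂ) * ellOf a v t = 0}
  add_mem' := by
    intro N M hN hM
    simp only [Set.mem_setOf_eq, Pi.add_apply, Rat.cast_add, add_mul, Finset.sum_add_distrib] at *
    rw [hN, hM, add_zero]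
  zero_mem' := by simp
  smul_mem' := by
    intro c N hN
    simp only [Set.mem_setOf_eq, Pi.smul_apply, smul_eq_mul, Rat.cast_mul, mul_assoc,
      ← Finset.mul_sum] at *
    rw [hN, mul_zero]

/-- An identity between `ℚ`-sa functions that holds at the algebraic points of `U` holds on `U` (its failure set is
`ℚ`-semialgebraic, so it would contain an algebraic point). -/
theorem eqOn_of_eq_at_algebraicPoints {n : ℕ} {U : Set (Fin n → ℝ)}
    {F G : (Fin n → ℝ) → ℝ} (hF : IsSemialgebraicFunOn ℚ U F) (hG : IsSemialgebraicFunOn ℚ U G)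
    (halg : ∀ x ∈ U, (∀ i, IsAlgebraic ℚ (x i)) → F x = G x) : ∀ x ∈ U, F x = G x := by
  intro x hx
  by_contra hne
  have hsa : IsSemialgebraic ℚ ({y | y ∈ U ∧ (fun y => F y - G y) y < 0} ∪
      {y | y ∈ U ∧ (fun y => G y - F y) y < 0}) :=
    (IsSemialgebraicFunOn.sub_holds hF hG).isSemialgebraic_sep_neg.union
      (IsSemialgebraicFunOn.sub_holds hG hF).isSemialgebraic_sep_neg
  have hxB : x ∈ ({y | y ∈ U ∧ (fun y => F y - G y) y < 0} ∪ {y | y ∈ U ∧ (fun y => G y - F y) y < 0}) := by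
    rcases lt_or_gt_of_ne hne with hlt | hgt
    · exact Or.inl ⟨hx, by simp only; linarith⟩
    · exact Or.inr ⟨hx, by simp only; linarith⟩
  obtain ⟨y, hy, hyalg⟩ := algebraicPoints _ hsa ⟨x, hxB⟩
  rcases hy with ⟨hyU, hylt⟩ | ⟨hyU, hylt⟩
  · have := halg y hyU hyalg; simp only at hylt; linarith
  · have := halg y hyU hyalg; simp only at hylt; linarith

end G13
end Summit.KontsevichZagierPeriods.RootDecompRelativeModAbsolute.Rung30571.RegularisedLogLayer.CylLog.Leaf
end
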